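import Summits.ValiantsHypothesis.ValiantsHypothesis.Theorems.KPlusLogSqLawTropicalBBanded

/-!
# Route `KPlusLogSqLaw`, crux `TropicalB` (stmt-ValiantsHypothesis-19771) — the CUT-WIDTH sector: POLYNOMIAL row bounds
# `(K+1)·2^((w+1)(⌊log₂ m⌋+1)) − 1 ≤ (K+1)·(2m)^(w+1)` when every column cut is straddled by at most `w` rows

HONEST FRAMING.  Helper toward the registered stubs `stub_tropThin` / `stub_tropFat` of `Cruxes/TropicalB/Lines/birth.lean`
(crux `Summit.ValiantsHypothesis.ValiantsHypothesis.Theses.KPlusLogSqLaw.TropicalB`, ledger item `stmt-ValiantsHypothesis-19771`,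
route `KPlusLogSqLaw`; cell `pub-symmetroid`, seat val-sym-trop-p5 g27, 2026-08-29; `--supports … --as helper`).  A SECTOR theorem of
an OPEN conjecture, obtained by running val-sym-trop-p1's split inequality `designRowD_split` (p420147) with a new, SMALLER state
family; it bounds nothing for `TropicalB` on general supports and bears on neither `WeakLifting`, DoorA26 / DoorA34, `MatrixDescartes`
(stmt-ValiantsHypothesis-18050) nor VP ≠ VNP.

THE SECTOR.  Rows are the first index of `ε`, columns the second (as in `termSign`).  A design has (column-)CUT-WIDTH `≤ w` when for
every cut `t` at most `w` rows are STRADDLING: they carry a present entry in some column `< t` AND a present entry in some column `≥ t`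
(hypothesis stated inline with `Set.ncard`; no definition is introduced).  Under the column split `c | e` of `designRowD_split` the
state of a present term (the rows used by the first `c` columns) contains every row having no present entry in a column `≥ c` and is
contained in those rows together with the straddling rows of the cut `c` (`state_mem`), so AT MOST `2^w` STATES occur
(`card_states_le`) — against `C(c+w, c) ≤ (c+1)^w` for the banded / Hall-surplus sectors of val-sym-trop-p3 (`…TropicalBBanded`,
`…TropicalBSurplus`), which contain this one (a cut-width-`w` design meets at most `c + w` rows in its first `c` columns).  Both
restricted designs have cut-width `≤ w` again (`cross_restrict_left/right`), and the dyadic recursion gives a bound that is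
POLYNOMIAL in `m` for fixed `w`, not only quasi-polynomial:

* `designRowD_cutwidth_pow` / `designRowD_cutwidth` : `DesignRowD d v ε ((K+1)·2^((w+1)·(⌊log₂ m⌋+1)) − 1)`, and
  `(K+1)·2^((w+1)(⌊log₂ m⌋+1)) ≤ (K+1)·(2m)^(w+1)` (`designRowD_cutwidth_poly`): exponent `w + 1` in `m`;
* `cutwidth_kPlusLogSq_fixedWidth` : the crux's inequality with `C = 2w + 3` on the sector (signed form, crux binders verbatim);
* `cutwidth_kPlusLogSq` : ONE absolute constant `C = 2` whenever `(w+1)·(⌊log₂ m⌋+1) ≤ K` — a sector widening linearly with `K`;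
* `cutwidth_kPlusLogSq_of_relabel` : the same after any relabeling of rows and columns (val-sym-trop-p1's `designRowD_of_relabel`).

READING (located, not claimed).  The exponent `w+1` is what a cubic `K = 4` family (the cell's D2 fork) or a counting-tight `(m, K)` column
must beat: a support all of whose column orders (after relabeling) have some cut straddled by `≥ K − 1` rows is necessary for
counting-tightness `T = C(m+K−1, m) − 1 ~ m^(K−1)` (large `m`, fixed `K`: `w ≥ K − 2`), and a `TropicalMonster` on `m ≤ 2^polylog(K)` nodes needs
cut-width growing faster than `K / polylog(K)` under every relabeling.  [folklore: Gusfield 1980 / Carstensen 1983 divide and conquer, in the dominance vocabulary; state family and packaging this seat]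
-/

set_option linter.dupNamespace false
set_option autoImplicit false

namespace Summit.ValiantsHypothesis.ValiantsHypothesis.Theorems.KPlusLogSqLaw

open Summit.ValiantsHypothesis.ValiantsHypothesis.Theorems.MatrixDescartes.Negative
open Summit.ValiantsHypothesis.ValiantsHypothesis.Theorems.LacunarySymmetroidMatrixDescartes
open Summit.ValiantsHypothesis.ValiantsHypothesis.Theorems.LacunarySymmetroidMatrixDescartes.TropicalCensus
open scoped BigOperators
open Finset

namespace Cutwidth

/-! ## 1. States of a cut-width-`w` design under the column split -/

section States

variable {c e K : ℕ} (w : ℕ)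

/-- the state of a present term lies between the rows WITHOUT late entries (`F`) and those rows plus the straddling rows of the
cut `c` (`Cr`): it is `F ∪ X` for a subset `X ⊆ Cr`, and it has `c` elements. [folklore] -/
theorem state_mem (ε : Fin (c + e) → Fin (c + e) → Fin K → ℤ) (Cr F : Finset (Fin (c + e)))
    (hCr : ∀ a, a ∈ Cr ↔ ((∃ b : Fin (c + e), ∃ l : Fin K, (b : ℕ) < c ∧ ε a b l ≠ 0) ∧
      (∃ b : Fin (c + e), ∃ l : Fin K, c ≤ (b : ℕ) ∧ ε a b l ≠ 0)))
    (hF : ∀ a, a ∈ F ↔ ¬ ∃ b : Fin (c + e), ∃ l : Fin K, c ≤ (b : ℕ) ∧ ε a b l ≠ 0)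
    (q : Equiv.Perm (Fin (c + e)) × (Fin (c + e) → Fin K)) (hq : termSign ε q ≠ 0) :
    ((univ : Finset (Fin c)).image fun j => q.1 (Fin.castAdd e j)) ∈
      (Cr.powerset.image (fun X => F ∪ X)).filter (fun R => R.card = c) := by
  classical
  set S := (univ : Finset (Fin c)).image fun j => q.1 (Fin.castAdd e j) with hS
  have hpres := (termSign_ne_zero_iff ε q).mp hq
  rw [mem_filter]
  refine ⟨?_, ?_⟩
  · rw [mem_image]
    refine ⟨S ∩ Cr, mem_powerset.mpr inter_subset_right, ?_⟩
    -- `F ∪ (S ∩ Cr) = S`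
    ext a
    rw [mem_union, mem_inter]
    constructor
    · rintro (haF | ⟨haS, _⟩)
      · -- a row without late entries is used by an early column
        rw [hF] at haF
        obtain ⟨i, hi⟩ : ∃ i, q.1 i = a := q.1.surjective a
        have hp := hpres i
        rw [hi] at hp
        have hic : (i : ℕ) < c := by
          by_contra hcon
          exact haF ⟨i, q.2 i, Nat.le_of_not_lt hcon, hp⟩
        rw [hS, mem_image]
        refine ⟨⟨i, hic⟩, mem_univ _, ?_⟩
        have hci : Fin.castAdd e (⟨i, hic⟩ : Fin c) = i := Fin.ext (by simp)
        rw [hci, hi]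
      · exact haS
    · intro haS
      by_cases haCr : a ∈ Cr
      · exact Or.inr ⟨haS, haCr⟩
      · left
        rw [hF]
        intro hlate
        apply haCr
        rw [hCr]
        refine ⟨?_, hlate⟩
        rw [hS, mem_image] at haS
        obtain ⟨j, _, hj⟩ := haS
        refine ⟨Fin.castAdd e j, q.2 (Fin.castAdd e j), by simp, ?_⟩
        rw [← hj]; exact hpres _
  · have hinj : Function.Injective fun j : Fin c => q.1 (Fin.castAdd e j) :=
      q.1.injective.comp (Fin.castAdd_injective _ _)
    rw [hS, card_image_of_injective _ hinj, card_univ, Fintype.card_fin]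

/-- **at most `2^w` states**: the state family is an image of the powerset of the straddling rows of the cut `c`. [folklore] -/
theorem card_states_le (ε : Fin (c + e) → Fin (c + e) → Fin K → ℤ) (Cr F : Finset (Fin (c + e)))
    (hCr : ∀ a, a ∈ Cr ↔ ((∃ b : Fin (c + e), ∃ l : Fin K, (b : ℕ) < c ∧ ε a b l ≠ 0) ∧
      (∃ b : Fin (c + e), ∃ l : Fin K, c ≤ (b : ℕ) ∧ ε a b l ≠ 0)))
    (hw : {a : Fin (c + e) | (∃ b : Fin (c + e), ∃ l : Fin K, (b : ℕ) < c ∧ ε a b l ≠ 0) ∧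
        (∃ b : Fin (c + e), ∃ l : Fin K, c ≤ (b : ℕ) ∧ ε a b l ≠ 0)}.ncard ≤ w) :
    ((Cr.powerset.image (fun X => F ∪ X)).filter (fun R => R.card = c)).card ≤ 2 ^ w := by
  classical
  have hCrw : Cr.card ≤ w := by
    have hset : (Cr : Set (Fin (c + e))) = {a : Fin (c + e) |
        (∃ b : Fin (c + e), ∃ l : Fin K, (b : ℕ) < c ∧ ε a b l ≠ 0) ∧
        (∃ b : Fin (c + e), ∃ l : Fin K, c ≤ (b : ℕ) ∧ ε a b l ≠ 0)} := by
      ext a; rw [mem_coe, hCr]; rfl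
    have h := Set.ncard_coe_finset Cr
    rw [hset] at h
    omega
  calc ((Cr.powerset.image (fun X => F ∪ X)).filter (fun R => R.card = c)).card
        ≤ (Cr.powerset.image (fun X => F ∪ X)).card := card_filter_le _ _
    _ ≤ Cr.powerset.card := card_image_le
    _ = 2 ^ Cr.card := card_powerset _
    _ ≤ 2 ^ w := Nat.pow_le_pow_right (by norm_num) hCrw

/-- the first restricted design (rows increasing, first column block) has cut-width `≤ w`: its straddling rows at a cut `t` map
injectively (by the row enumeration) into the straddling rows of the same cut of the whole design. [folklore] -/
theorem cross_restrict_left (ε : Fin (c + e) → Fin (c + e) → Fin K → ℤ)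
    (hw : ∀ t : ℕ, {a : Fin (c + e) | (∃ b : Fin (c + e), ∃ l : Fin K, (b : ℕ) < t ∧ ε a b l ≠ 0) ∧
        (∃ b : Fin (c + e), ∃ l : Fin K, t ≤ (b : ℕ) ∧ ε a b l ≠ 0)}.ncard ≤ w)
    (r : Fin c ↪o Fin (c + e)) (t : ℕ) :
    {i : Fin c | (∃ j : Fin c, ∃ l : Fin K, (j : ℕ) < t ∧ ε (r i) (Fin.castAdd e j) l ≠ 0) ∧
        (∃ j : Fin c, ∃ l : Fin K, t ≤ (j : ℕ) ∧ ε (r i) (Fin.castAdd e j) l ≠ 0)}.ncard ≤ w := by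
  refine le_trans ?_ (hw t)
  refine Set.ncard_le_ncard_of_injOn r (fun i hi => ?_) (fun i _ i' _ h => r.injective h)
  obtain ⟨⟨j, l, hj, h⟩, ⟨j', l', hj', h'⟩⟩ := hi
  exact ⟨⟨Fin.castAdd e j, l, by simpa using hj, h⟩, ⟨Fin.castAdd e j', l', by simpa using hj', h'⟩⟩

/-- the second restricted design (rows increasing, second column block) has cut-width `≤ w`: its cut `t` is the cut `c + t` of the
whole design. [folklore] -/
theorem cross_restrict_right (ε : Fin (c + e) → Fin (c + e) → Fin K → ℤ)
    (hw : ∀ t : ℕ, {a : Fin (c + e) | (∃ b : Fin (c + e), ∃ l : Fin K, (b : ℕ) < t ∧ ε a b l ≠ 0) ∧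
        (∃ b : Fin (c + e), ∃ l : Fin K, t ≤ (b : ℕ) ∧ ε a b l ≠ 0)}.ncard ≤ w)
    (r : Fin e ↪o Fin (c + e)) (t : ℕ) :
    {i : Fin e | (∃ j : Fin e, ∃ l : Fin K, (j : ℕ) < t ∧ ε (r i) (Fin.natAdd c j) l ≠ 0) ∧
        (∃ j : Fin e, ∃ l : Fin K, t ≤ (j : ℕ) ∧ ε (r i) (Fin.natAdd c j) l ≠ 0)}.ncard ≤ w := by
  refine le_trans ?_ (hw (c + t))
  refine Set.ncard_le_ncard_of_injOn r (fun i hi => ?_) (fun i _ i' _ h => r.injective h)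
  obtain ⟨⟨j, l, hj, h⟩, ⟨j', l', hj', h'⟩⟩ := hi
  exact ⟨⟨Fin.natAdd c j, l, by simp; omega, h⟩, ⟨Fin.natAdd c j', l', by simp; omega, h'⟩⟩

end States

/-! ## 2. The polynomial bound for cut-width-`w` designs -/

/-- **dyadic form.**  Every design of cut-width `≤ w` and format `m ≤ 2^t` with `K` classes has unsigned row bound
`(K + 1)·2^((w+1)·t) − 1`. [folklore: Gusfield 1980 divide and conquer, cut-width form] -/
theorem designRowD_cutwidth_pow (K w t : ℕ) : ∀ m : ℕ, m ≤ 2 ^ t →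
    ∀ (d : Fin K → ℕ) (v ε : Fin m → Fin m → Fin K → ℤ),
      (∀ s : ℕ, {a : Fin m | (∃ b : Fin m, ∃ l : Fin K, (b : ℕ) < s ∧ ε a b l ≠ 0) ∧
        (∃ b : Fin m, ∃ l : Fin K, s ≤ (b : ℕ) ∧ ε a b l ≠ 0)}.ncard ≤ w) →
      DesignRowD d v ε ((K + 1) * 2 ^ ((w + 1) * t) - 1) := by
  induction t with
  | zero =>
    intro m hm d v ε _
    have hm1 : m ≤ 1 := by simpa using hm
    rcases Nat.le_one_iff_eq_zero_or_eq_one.mp hm1 with rfl | rfl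
    · exact designRowD_mono (Nat.zero_le _) (tropRowD_size_zero K 0 d v ε)
    · refine designRowD_mono ?_ (tropRowD_one K d v ε)
      simp
  | succ t ih =>
    intro m hm d v ε hε
    set G := (K + 1) * 2 ^ ((w + 1) * t) with hG
    have hGpos : 1 ≤ G := by
      have : 1 ≤ 2 ^ ((w + 1) * t) := Nat.one_le_two_pow
      simp only [hG]; nlinarith
    -- the bound is monotone in `t`
    have hmonoG : G - 1 ≤ (K + 1) * 2 ^ ((w + 1) * (t + 1)) - 1 := by
      have : 2 ^ ((w + 1) * t) ≤ 2 ^ ((w + 1) * (t + 1)) :=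
        Nat.pow_le_pow_right (by norm_num) (Nat.mul_le_mul_left _ (Nat.le_succ _))
      have := Nat.mul_le_mul_left (K + 1) this
      simp only [hG]; omega
    by_cases hsmall : m ≤ 2 ^ t
    · exact designRowD_mono hmonoG (ih m hsmall d v ε hε)
    -- split `m = c + e'` with `c = m / 2 ≤ e' ≤ 2^t`
    obtain ⟨c, e', rfl, hc, he', _⟩ : ∃ c e', m = c + e' ∧ c ≤ 2 ^ t ∧ e' ≤ 2 ^ t ∧ c ≤ e' := by
      refine ⟨m / 2, m - m / 2, by omega, ?_, ?_, by omega⟩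
      · have : 2 ^ (t + 1) = 2 * 2 ^ t := by ring
        omega
      · have : 2 ^ (t + 1) = 2 * 2 ^ t := by ring
        omega
    classical
    set Cr := (univ : Finset (Fin (c + e'))).filter (fun a : Fin (c + e') =>
        (∃ b : Fin (c + e'), ∃ l : Fin K, (b : ℕ) < c ∧ ε a b l ≠ 0) ∧
        (∃ b : Fin (c + e'), ∃ l : Fin K, c ≤ (b : ℕ) ∧ ε a b l ≠ 0)) with hCrdef
    set F := (univ : Finset (Fin (c + e'))).filter (fun a : Fin (c + e') =>
        ¬ ∃ b : Fin (c + e'), ∃ l : Fin K, c ≤ (b : ℕ) ∧ ε a b l ≠ 0) with hFdef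
    have hCr : ∀ a, a ∈ Cr ↔ ((∃ b : Fin (c + e'), ∃ l : Fin K, (b : ℕ) < c ∧ ε a b l ≠ 0) ∧
        (∃ b : Fin (c + e'), ∃ l : Fin K, c ≤ (b : ℕ) ∧ ε a b l ≠ 0)) := fun a => by
      rw [hCrdef, mem_filter]; simp
    have hF : ∀ a, a ∈ F ↔ ¬ ∃ b : Fin (c + e'), ∃ l : Fin K, c ≤ (b : ℕ) ∧ ε a b l ≠ 0 := fun a => by
      rw [hFdef, mem_filter]; simp
    set 𝓡 := (Cr.powerset.image (fun X => F ∪ X)).filter (fun R => R.card = c) with h𝓡def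
    have hsplit := designRowD_split d v ε 𝓡 (fun R hR => (mem_filter.mp hR).2)
      (B₁ := G - 1) (B₂ := G - 1)
      (fun R _ r _ => ih c hc d _ _ (cross_restrict_left w ε hε r))
      (fun R _ r _ => ih e' he' d _ _ (cross_restrict_right w ε hε r))
      (fun q hq => state_mem ε Cr F hCr hF q hq)
    refine designRowD_mono ?_ hsplit
    -- arithmetic: `#𝓡·(2(G − 1) + 1) − 1 ≤ 2^w · 2G − 1 = (K+1)·2^((w+1)(t+1)) − 1`
    have hstates : 𝓡.card ≤ 2 ^ w := card_states_le w ε Cr F hCr (hε c)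
    have h1 : 𝓡.card * (G - 1 + (G - 1) + 1) ≤ 2 ^ w * (2 * G) :=
      calc 𝓡.card * (G - 1 + (G - 1) + 1) ≤ 2 ^ w * (G - 1 + (G - 1) + 1) := Nat.mul_le_mul_right _ hstates
        _ ≤ 2 ^ w * (2 * G) := Nat.mul_le_mul_left _ (by omega)
    have h2 : 2 ^ w * (2 * G) = (K + 1) * 2 ^ ((w + 1) * (t + 1)) := by
      have : 2 ^ ((w + 1) * (t + 1)) = 2 ^ w * 2 * 2 ^ ((w + 1) * t) := by
        rw [← pow_succ, ← pow_add]; congr 1; ring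
      rw [this]; simp only [hG]; ring
    omega

/-- **cut-width form.**  Every design of cut-width `≤ w` and format `(m, K)` has unsigned row bound
`(K + 1)·2^((w+1)·(⌊log₂ m⌋ + 1)) − 1`. [folklore: Gusfield 1980 divide and conquer, cut-width form] -/
theorem designRowD_cutwidth {m K : ℕ} (w : ℕ) (d : Fin K → ℕ) (v ε : Fin m → Fin m → Fin K → ℤ)
    (hε : ∀ s : ℕ, {a : Fin m | (∃ b : Fin m, ∃ l : Fin K, (b : ℕ) < s ∧ ε a b l ≠ 0) ∧
        (∃ b : Fin m, ∃ l : Fin K, s ≤ (b : ℕ) ∧ ε a b l ≠ 0)}.ncard ≤ w) :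
    DesignRowD d v ε ((K + 1) * 2 ^ ((w + 1) * (Nat.log 2 m + 1)) - 1) :=
  designRowD_cutwidth_pow K w (Nat.log 2 m + 1) m (Nat.lt_pow_succ_log_self (by norm_num) m).le d v ε hε

/-- arithmetic: `2^(⌊log₂ m⌋ + 1) ≤ 2m` for `m ≥ 1`, hence `2^((w+1)(⌊log₂ m⌋+1)) ≤ (2m)^(w+1)`. [folklore] -/
theorem two_pow_log_succ_mul_le {m : ℕ} (hm : 1 ≤ m) (w : ℕ) :
    2 ^ ((w + 1) * (Nat.log 2 m + 1)) ≤ (2 * m) ^ (w + 1) := by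
  have h1 : 2 ^ (Nat.log 2 m + 1) ≤ 2 * m := by
    rw [pow_succ]
    have := Nat.pow_log_le_self 2 (by omega : m ≠ 0)
    omega
  calc 2 ^ ((w + 1) * (Nat.log 2 m + 1)) = (2 ^ (Nat.log 2 m + 1)) ^ (w + 1) := by rw [← pow_mul, Nat.mul_comm]
    _ ≤ (2 * m) ^ (w + 1) := Nat.pow_le_pow_left h1 _

/-- **POLYNOMIAL form.**  Every design of cut-width `≤ w` and format `(m, K)`, `m ≥ 1`, has unsigned row bound
`(K + 1)·(2m)^(w+1) − 1`: exponent `w + 1` in `m`. [folklore: Gusfield 1980 divide and conquer, cut-width form] -/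
theorem designRowD_cutwidth_poly {m K : ℕ} (hm : 1 ≤ m) (w : ℕ) (d : Fin K → ℕ) (v ε : Fin m → Fin m → Fin K → ℤ)
    (hε : ∀ s : ℕ, {a : Fin m | (∃ b : Fin m, ∃ l : Fin K, (b : ℕ) < s ∧ ε a b l ≠ 0) ∧
        (∃ b : Fin m, ∃ l : Fin K, s ≤ (b : ℕ) ∧ ε a b l ≠ 0)}.ncard ≤ w) :
    DesignRowD d v ε ((K + 1) * (2 * m) ^ (w + 1) - 1) := by
  refine designRowD_mono ?_ (designRowD_cutwidth w d v ε hε)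
  have := Nat.mul_le_mul_left (K + 1) (two_pow_log_succ_mul_le hm w)
  omega

/-! ## 3. The `K + log² m` law on the cut-width sector -/

/-- arithmetic, fixed width: for `L ≥ 1` the cut-width bound sits inside the `K + log² m` budget with `C = 2w + 3`. [folklore] -/
theorem cutwidthBound_le_fixedWidth (K L w : ℕ) (hL : 1 ≤ L) :
    (K + 1) * 2 ^ ((w + 1) * (L + 1)) - 1 ≤ 2 ^ ((2 * w + 3) * (K + L ^ 2)) := by
  have hK : K + 1 ≤ 2 ^ K := Nat.lt_two_pow_self
  have hLL : L + 1 ≤ 2 * L ^ 2 := by nlinarith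
  calc (K + 1) * 2 ^ ((w + 1) * (L + 1)) - 1 ≤ (K + 1) * 2 ^ ((w + 1) * (L + 1)) := Nat.sub_le _ _
    _ ≤ 2 ^ K * 2 ^ ((w + 1) * (L + 1)) := Nat.mul_le_mul_right _ hK
    _ = 2 ^ (K + (w + 1) * (L + 1)) := by rw [← pow_add]
    _ ≤ 2 ^ ((2 * w + 3) * (K + L ^ 2)) := Nat.pow_le_pow_right (by norm_num) (by
        have := Nat.mul_le_mul_left (w + 1) hLL
        nlinarith)

/-- arithmetic, K-adaptive width: if `(w+1)·(L+1) ≤ K` the cut-width bound sits inside the budget with `C = 2`. [folklore] -/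
theorem cutwidthBound_le_adaptive (K L w : ℕ) (hw : (w + 1) * (L + 1) ≤ K) :
    (K + 1) * 2 ^ ((w + 1) * (L + 1)) - 1 ≤ 2 ^ (2 * (K + L ^ 2)) := by
  have hK : K + 1 ≤ 2 ^ K := Nat.lt_two_pow_self
  calc (K + 1) * 2 ^ ((w + 1) * (L + 1)) - 1 ≤ (K + 1) * 2 ^ ((w + 1) * (L + 1)) := Nat.sub_le _ _
    _ ≤ 2 ^ K * 2 ^ ((w + 1) * (L + 1)) := Nat.mul_le_mul_right _ hK
    _ = 2 ^ (K + (w + 1) * (L + 1)) := by rw [← pow_add]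
    _ ≤ 2 ^ (2 * (K + L ^ 2)) := Nat.pow_le_pow_right (by norm_num) (by nlinarith)

/-- **The `K + log² m` law on the cut-width sector, fixed width (unsigned form): `C = 2w + 3`.** [folklore: Gusfield 1980, cut-width
form, in the dominance vocabulary] -/
theorem cutwidth_kPlusLogSq_fixedWidth_unsigned {m K : ℕ} (w : ℕ) (d : Fin K → ℕ) (v ε : Fin m → Fin m → Fin K → ℤ)
    (hε : ∀ s : ℕ, {a : Fin m | (∃ b : Fin m, ∃ l : Fin K, (b : ℕ) < s ∧ ε a b l ≠ 0) ∧
        (∃ b : Fin m, ∃ l : Fin K, s ≤ (b : ℕ) ∧ ε a b l ≠ 0)}.ncard ≤ w) :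
    DesignRowD d v ε (2 ^ ((2 * w + 3) * (K + Nat.log 2 m ^ 2))) := by
  rcases Nat.lt_or_ge m 2 with hm | hm
  · exact designRowD_small (by omega) _ (by omega) d v ε
  · have hL : 1 ≤ Nat.log 2 m := Nat.log_pos (by norm_num) hm
    exact designRowD_mono (cutwidthBound_le_fixedWidth K _ w hL) (designRowD_cutwidth w d v ε hε)

/-- **The `K + log² m` law on the K-ADAPTIVE cut-width sector (unsigned form): ONE constant `C = 2` for every design whose
cut-width `w` satisfies `(w + 1)·(⌊log₂ m⌋ + 1) ≤ K`.** [folklore: Gusfield 1980, cut-width form, in the dominance vocabulary] -/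
theorem cutwidth_kPlusLogSq_unsigned {m K : ℕ} (w : ℕ) (d : Fin K → ℕ) (v ε : Fin m → Fin m → Fin K → ℤ)
    (hε : ∀ s : ℕ, {a : Fin m | (∃ b : Fin m, ∃ l : Fin K, (b : ℕ) < s ∧ ε a b l ≠ 0) ∧
        (∃ b : Fin m, ∃ l : Fin K, s ≤ (b : ℕ) ∧ ε a b l ≠ 0)}.ncard ≤ w)
    (hw : (w + 1) * (Nat.log 2 m + 1) ≤ K) :
    DesignRowD d v ε (2 ^ (2 * (K + Nat.log 2 m ^ 2))) :=
  designRowD_mono (cutwidthBound_le_adaptive K _ w hw) (designRowD_cutwidth w d v ε hε)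

/-- **The `K + log² m` law on the cut-width sector, fixed width.**  For every `w` there is `C` (`= 2w + 3`) such that for all `m, K`
and every design of format `(m, K)` whose every column cut is straddled by at most `w` rows, every chain of terms dominant at strictly
increasing integer slopes with alternating signs has at most `2^(C·(K + (log₂ m)²))` breakpoints — the statement of the crux
`TropicalB` restricted to the cut-width-`w` class.  HONEST RANGE: a restricted class, one constant per width. [folklore: Gusfield 1980,
in the dominance vocabulary] -/
theorem cutwidth_kPlusLogSq_fixedWidth (w : ℕ) : ∃ C : ℕ, ∀ (m K : ℕ) (d : Fin K → ℕ)
    (v ε : Fin m → Fin m → Fin K → ℤ),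
    (∀ s : ℕ, {a : Fin m | (∃ b : Fin m, ∃ l : Fin K, (b : ℕ) < s ∧ ε a b l ≠ 0) ∧
        (∃ b : Fin m, ∃ l : Fin K, s ≤ (b : ℕ) ∧ ε a b l ≠ 0)}.ncard ≤ w) →
    ∀ (n : ℕ) (θ : Fin (n + 1) → ℤ) (p : Fin (n + 1) → Equiv.Perm (Fin m) × (Fin m → Fin K)),
      (∀ i j l, (ε i j l).natAbs ≤ 1) → StrictMono θ → (∀ k, IsDominant d v ε (θ k) (p k)) →
      (∀ k : Fin n, termSign ε (p k.castSucc) * termSign ε (p k.succ) < 0) →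
      n ≤ 2 ^ (C * (K + Nat.log 2 m ^ 2)) :=
  ⟨2 * w + 3, fun _ _ d v ε hε _ θ p _ hθ hdom halt =>
    le_of_designRowD (cutwidth_kPlusLogSq_fixedWidth_unsigned w d v ε hε) θ p hθ hdom halt⟩

/-- **The `K + log² m` law on the K-adaptive cut-width sector: ONE absolute constant.**  For all `m, K, w` with
`(w+1)·(⌊log₂ m⌋+1) ≤ K` and every design of format `(m, K)` of cut-width `≤ w`, every chain of terms dominant at strictly increasing
integer slopes with alternating signs has at most `2^(2·(K + (log₂ m)²))` breakpoints; in the fat regime this admits cut-width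
`K / (⌊log₂ m⌋ + 1) − 1`, a sector widening LINEARLY with `K`.  HONEST RANGE: a restricted class; `TropicalB` quantifies over all designs.
[folklore: Gusfield 1980, in the dominance vocabulary] -/
theorem cutwidth_kPlusLogSq {m K : ℕ} (w : ℕ) (d : Fin K → ℕ) (v ε : Fin m → Fin m → Fin K → ℤ)
    (hε : ∀ s : ℕ, {a : Fin m | (∃ b : Fin m, ∃ l : Fin K, (b : ℕ) < s ∧ ε a b l ≠ 0) ∧
        (∃ b : Fin m, ∃ l : Fin K, s ≤ (b : ℕ) ∧ ε a b l ≠ 0)}.ncard ≤ w)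
    (hw : (w + 1) * (Nat.log 2 m + 1) ≤ K)
    {n : ℕ} (θ : Fin (n + 1) → ℤ) (p : Fin (n + 1) → Equiv.Perm (Fin m) × (Fin m → Fin K))
    (hθ : StrictMono θ) (hdom : ∀ k, IsDominant d v ε (θ k) (p k))
    (halt : ∀ k : Fin n, termSign ε (p k.castSucc) * termSign ε (p k.succ) < 0) :
    n ≤ 2 ^ (2 * (K + Nat.log 2 m ^ 2)) :=
  le_of_designRowD (cutwidth_kPlusLogSq_unsigned w d v ε hε hw) θ p hθ hdom halt

/-- **Relabeled cut-width designs.**  If some relabeling of rows and columns (`π`, `ρ`) makes every column cut straddled by at most `w`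
rows, with `(w+1)·(⌊log₂ m⌋+1) ≤ K`, the same bound `2^(2·(K + (log₂ m)²))` holds (dominant chains are invariant under relabeling,
val-sym-trop-p1's `designRowD_of_relabel`). [folklore] -/
theorem cutwidth_kPlusLogSq_of_relabel {m K : ℕ} (w : ℕ) (d : Fin K → ℕ) (v ε : Fin m → Fin m → Fin K → ℤ)
    (π ρ : Equiv.Perm (Fin m))
    (hε : ∀ s : ℕ, {a : Fin m | (∃ b : Fin m, ∃ l : Fin K, (b : ℕ) < s ∧ ε (π a) (ρ b) l ≠ 0) ∧
        (∃ b : Fin m, ∃ l : Fin K, s ≤ (b : ℕ) ∧ ε (π a) (ρ b) l ≠ 0)}.ncard ≤ w)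
    (hw : (w + 1) * (Nat.log 2 m + 1) ≤ K)
    {n : ℕ} (θ : Fin (n + 1) → ℤ) (p : Fin (n + 1) → Equiv.Perm (Fin m) × (Fin m → Fin K))
    (hθ : StrictMono θ) (hdom : ∀ k, IsDominant d v ε (θ k) (p k))
    (halt : ∀ k : Fin n, termSign ε (p k.castSucc) * termSign ε (p k.succ) < 0) :
    n ≤ 2 ^ (2 * (K + Nat.log 2 m ^ 2)) :=
  le_of_designRowD (designRowD_of_relabel d v ε π ρ
    (cutwidth_kPlusLogSq_unsigned w d (fun a b l => v (π a) (ρ b) l) (fun a b l => ε (π a) (ρ b) l) hε hw))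
    θ p hθ hdom halt

/-- **Polynomial unsigned form after relabeling**: if some relabeling of rows and columns gives cut-width `≤ w`, every unsigned
dominant chain has `n ≤ (K + 1)·(2m)^(w+1) − 1` (`m ≥ 1`).  READING for the cell's `K = 4` fork: a family with `Θ(m³)` dominant terms
needs, under EVERY relabeling, a column cut straddled by at least `2` rows; a counting-tight `(m, K)` column needs one straddled by
`≥ K − 2` rows. [folklore] -/
theorem designRowD_cutwidth_poly_of_relabel {m K : ℕ} (hm : 1 ≤ m) (w : ℕ) (d : Fin K → ℕ)
    (v ε : Fin m → Fin m → Fin K → ℤ) (π ρ : Equiv.Perm (Fin m))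
    (hε : ∀ s : ℕ, {a : Fin m | (∃ b : Fin m, ∃ l : Fin K, (b : ℕ) < s ∧ ε (π a) (ρ b) l ≠ 0) ∧
        (∃ b : Fin m, ∃ l : Fin K, s ≤ (b : ℕ) ∧ ε (π a) (ρ b) l ≠ 0)}.ncard ≤ w) :
    DesignRowD d v ε ((K + 1) * (2 * m) ^ (w + 1) - 1) :=
  designRowD_of_relabel d v ε π ρ
    (designRowD_cutwidth_poly hm w d (fun a b l => v (π a) (ρ b) l) (fun a b l => ε (π a) (ρ b) l) hε)

end Cutwidth

end Summit.ValiantsHypothesis.ValiantsHypothesis.Theorems.KPlusLogSqLaw
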